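import Summits.AnomalousDissipation.AnomalousDissipation.Theorems.SolenoidalFractalHomogenisationLagrangianCarrierDistortion
import Summits.AnomalousDissipation.AnomalousDissipation.Theorems.SolenoidalFractalHomogenisationLagrangianStepFrameMatrix
import Summits.AnomalousDissipation.AnomalousDissipation.Theorems.SolenoidalFractalHomogenisationLagrangianStepFrameDefs
import HarnessLib

/-!
# K1L_D (stmt-AnomalousDissipation-27980), sub-stub S1′ `stub_conjugateL` (a): ENTRYWISE DISTORTION of the frame on a refresh window
# (helper; `--supports … --as helper`)

From the operator bound `‖flowDeriv m t w x − id‖ ≤ exp (K (t − w)) − 1` of `…LagrangianCarrierDistortion` (p615383) and the matrix bricks of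
`…LagrangianStepFrameMatrix` (p647148): on a window where the coarse partial sum is `K`-Lipschitz, the Jacobian matrix `frameJac` of the coarse flow
is entrywise within `ε := exp (K (t − w)) − 1` of the identity, and — as long as `3ε < 1` — its inverse `frameG` (the distortion field of the distorted
weak class) is entrywise within `3ε / (1 − 3ε)` of the identity.  First two conjuncts of S1′(a) of the lead's sub-split
(`Cruxes/LagrangianRenormalisationStep/Lines/onelevel_S23_split.lean`), modulo the Lipschitz constant `K` of `b_{≤m}` (the distortion tower supplies
`K ≤ Cd·Σ_{i≤m} a_i`, so that `K·refresh(m+1) ≤ Cd·strain m`).  Infrastructure for rung F-D1.A0; NOT a proof of the crux or of anomalous dissipation.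
-/

set_option linter.dupNamespace false

namespace Summit.AnomalousDissipation.AnomalousDissipation.Theorems.SolenoidalFractalHomogenisation.LagrangianStep

open Set Function
open scoped NNReal
open Literature.Analysis Literature.Analysis.FunctionSpaces Literature.Analysis.FunctionSpaces.Torus
open Literature.Analysis.FluidPDE Literature.Analysis.FluidPDE.LatticeShear
open Summit.AnomalousDissipation.AnomalousDissipation.Theorems.SolenoidalFractalHomogenisation.LagrangianCarrier

noncomputable section

variable {k : ℕ}

/-- **The Jacobian matrix of the coarse flow is entrywise near the identity on a window**:
`|frameJac E m t w x a c − δ_{ac}| ≤ exp (K (t − w)) − 1`. -/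
theorem abs_frameJac_sub_one_le (E : LagrangianLatticeCarrier k) (m : ℕ) (hF : E.IsFlow m) {w T₁ : ℝ} {K : ℝ≥0}
    (hc : Continuous (uncurry (E.partialSum m)))
    (hK : ∀ r ∈ Icc w T₁, LipschitzWith K (lift (E.partialSum m r)))
    (hdc : ∀ x, ContinuousOn (fun t => E.disp m t w x) (Icc w T₁)) {t : ℝ} (ht : t ∈ Icc w T₁)
    (x : UnitAddTorus (Fin 3)) (a c : Fin 3) :
    |frameJac E m t w x a c - (1 : Matrix (Fin 3) (Fin 3) ℝ) a c| ≤ Real.exp (K * (t - w)) - 1 := by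
  have hop := norm_flowDeriv_sub_id_le_of_isFlow E m hF hc hK hdc ht x
  have hentry := abs_apply_single_sub_le_opNorm (E.flowDeriv m t w x) a c
  rw [frameJac, Matrix.of_apply, Matrix.one_apply]
  exact hentry.trans hop

/-- **The inverse Jacobian (distortion field) is entrywise near the identity on a window**: with `ε := exp (K (t − w)) − 1` and `3ε < 1`,
`|frameG E m t w x a c − δ_{ac}| ≤ 3ε / (1 − 3ε)`. -/
theorem abs_frameG_sub_one_le (E : LagrangianLatticeCarrier k) (m : ℕ) (hF : E.IsFlow m) {w T₁ : ℝ} {K : ℝ≥0}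
    (hc : Continuous (uncurry (E.partialSum m)))
    (hK : ∀ r ∈ Icc w T₁, LipschitzWith K (lift (E.partialSum m r)))
    (hdc : ∀ x, ContinuousOn (fun t => E.disp m t w x) (Icc w T₁)) {t : ℝ} (ht : t ∈ Icc w T₁)
    (hsmall : 3 * (Real.exp (K * (t - w)) - 1) < 1) (x : UnitAddTorus (Fin 3)) (a c : Fin 3) :
    |frameG E m t w x a c - (1 : Matrix (Fin 3) (Fin 3) ℝ) a c|
      ≤ 3 * (Real.exp (K * (t - w)) - 1) / (1 - 3 * (Real.exp (K * (t - w)) - 1)) := by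
  have hε : 0 ≤ Real.exp (K * (t - w)) - 1 := by
    have : (1 : ℝ) ≤ Real.exp (K * (t - w)) := Real.one_le_exp (mul_nonneg K.coe_nonneg (by linarith [ht.1]))
    linarith
  have hcard : (Fintype.card (Fin 3) : ℝ) * (Real.exp (K * (t - w)) - 1) < 1 := by
    simpa [Fintype.card_fin] using hsmall
  have h := abs_inv_sub_one_le (frameJac E m t w x) hε hcard
    (fun i j => abs_frameJac_sub_one_le E m hF hc hK hdc ht x i j) a c
  rw [frameG]
  simpa [Fintype.card_fin] using h

end

end Summit.AnomalousDissipation.AnomalousDissipation.Theorems.SolenoidalFractalHomogenisation.LagrangianStep
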